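import Summits.ABC.IUTFork.Thm311RealInd2IsmZHat
import Summits.ABC.IUTFork.Thm311RealInd2IsmUnitScalar
import Literature.AnabelianGeometry.AbsoluteAnabelian.GaloisPadicLogMLFUnfold
import Literature.AnabelianGeometry.EtaleTheta.ZHatPadicCharacterSurjective
import Literature.IUT.LogVolume.PadicSubfields
import Literature.IUT.LogVolume.LocalUnitLogEquivariance
import Literature.IUT.LogThetaLattice.LogShellContainersAlgebraIsos
import Literature.IUT.HodgeTheaters.GaloisValDatumOfComplete
import HarnessLib

/-!
# [IUTchIII] Thm. 3.11 (i) (Ind2), print-literal at `𝕍^non`: the GALOIS `p_v`-adic logarithm IS the analytic one,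
# and print's (Ind2)-group at `v` through the analytic logarithm is EXACTLY the `p`-adic unit scalars `ℤ_p^×`

PROOF-ONLY file (abc-iut cell, WAVE-5 seat abc-iut-w5-d216 gen 5; TEAM R indFixes thread × abc-iut-c312-1's R8 «print's
nonarchimedean Ism»; discharges the caveat of `Thm311RealInd2IsmZHat` «its agreement with c312-5's analytic `Real.analyticLogv`
is the classical uniqueness of the `p`-adic logarithm … not re-derived here» and abc-iut-c312-1 gen-7 HANDOFF open item
«galoisLog = analyticLogv compatibility»); TAKES NO SIDE on [IUTchIII] Cor. 3.12.

* `Real.natCast_residueChar_closureAt_mem` — the residue characteristic `p_v` of `K_v` (`(closureAt v).residueChar`) lies in `v`.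
* **`Real.galoisLog_apply_eq_unitLog`** / **`Real.galoisLog_eq_analyticLogv`** — the GALOIS logarithm of [AbsTopIII] Def. 3.1 (i)
  (abc-iut-L6-d2's `MLFClosure.galoisPadicLog` = the Iwasawa logarithm of `ℚ̄_p` transported along `K̄_v ≃ₐ[ℚ_p] ℚ̄_p`,
  restricted to `𝒪_v^×` and read in `K_v` — c312-1's `Real.galoisLog v`) EQUALS abc-iut-S1's analytic `log_p = unitLog`
  computed in abc-iut-S7's rescaled completion `K_v^{(1/n_v)}`, i.e. c312-5's `Real.analyticLogv F v`.  Route: the composite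
  `K_v^{(1/n_v)} → K̄_v ≃ ℚ̄_p` is a `ℚ_p`-algebra homomorphism out of an algebraic normed extension, hence NORM-PRESERVING
  (`norm_map_algHom_of_isAlgebraic`, uniqueness of the extended absolute value); S1's `log_p` commutes with norm-preserving
  ring homomorphisms of complete fields (`unitLog_map`, applied into the finite image field) and agrees with the Iwasawa
  logarithm on finite subfields of `ℚ̄_p` (`coe_unitLog_eq_padicLogAlgCl`).
* `Real.ismIsmOf_galoisLog_eq`, **`Real.mulPadicUnitScalar_mem_ismIsmOf_analyticLogv`** — c312-1's `Ẑ^×` non-vacuity (p443508: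
  `x ↦ χ_p(û)·x ∈ Real.ismIsmOf v (galoisLog v)`) transported to the ANALYTIC binder every Team-R / branch-C file quantifies over.
* **`Real.mem_ismIsm_analyticLogv_iff_exists_unit_scalar`** / **`Real.ismIsm_analyticLogv_eq_unitScalars`** — PRINT'S (Ind2)-GROUP AT
  A FINITE PLACE `v`, realised through the analytic logarithm (c312-1's `Real.ismIsm (analyticLogv F) v`), IS EXACTLY
  `{a ↦ c·a : c ∈ ℚ_p, ‖c‖ = 1} = ℤ_p^×·id` on `K_v`: `⊆` is this lineage's `exists_unit_scalar_of_mem_ismIsm` (p445977),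
  `⊇` is the transported `Ẑ^×` non-vacuity with `Ẑ^× ↠ ℤ_p^×` (`ZHatLevel.padicChar_surjective_units`).

Reading for the record (§A (Ind2) slot, neutral, about OUR typings): Mochizuki's "`Ẑ^× ↠ ℤ_p^× ↪ Ism`" ([IUTchII] Ex. 1.8 (iv))
read on the real log-shell `K_v` through THE (analytic = Galois) `p_v`-adic logarithm is a BIJECTION onto print's (Ind2)-group at
`v` as typed by c312-1: no element of `Ism(G_v)` does anything on `K_v` but multiply by a `p`-adic unit.  Dupuy–Hilado's
`Aut_{ℚ_p}(K_v : I_v)` (c312-5 `Real.ismDH`) is `GL_{ℤ_p}(I_v) ⊋ ℤ_p^×` whenever `n_v ≥ 2`.  Nothing here asserts that abc is proved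
or refuted; (Ind1), (Ind3) and Cor. 3.12 are untouched.  [claim: Mochizuki2012, status: disputed] for the [IUTchII]/[IUTchIII]
quotations; [cite: MochizukiAbsTopIII2015, Definition 3.1 (i) p.66]; [cite: NeukirchANT1999, Ch. II Prop. (5.5)];
[cite: RibesZalesskii2010, Thm 2.7.1]; [cite: DupuyHilado2025, §4.9].  Axioms: standard three.
-/

set_option autoImplicit false

noncomputable section

open Metric Set

namespace Summit.ABC.IUTFork.Thm311.Real

open NumberField IsDedekindDomain Literature.IUT.LogVolume Literature.IUT.LogThetaLattice
open Literature.NumberTheory.NumberFields Literature.AnabelianGeometry.AbsoluteAnabelian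
open Literature.NumberTheory.GaloisRepresentations Literature.NumberTheory.Transcendental
open Literature.IUT.HodgeArakelov Literature.AnabelianGeometry.EtaleTheta
open scoped ValuativeRel

variable {F : Type} [Field F] [NumberField F] (v : HeightOneSpectrum (𝓞 F))

/-! ## 1. The residue characteristic of `K_v` lies in `v` -/

/-- The residue characteristic `p_v = char 𝓀[K_v]` of the local field `K_v` lies in the prime `v`: `|p_v|_v < 1`
(abc-iut-L6-d2's `MLFClosure.valuation_ringChar_lt_one`) read through Mathlib's `valued_coe` / `valuation_lt_one_iff_mem`.
[folklore] -/
theorem natCast_residueChar_closureAt_mem : (((closureAt v).residueChar : ℕ) : 𝓞 F) ∈ v.asIdeal := by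
  have h : ValuativeRel.valuation (v.adicCompletion F) ((closureAt v).residueChar : v.adicCompletion F) < 1 :=
    (closureAt v).valuation_ringChar_lt_one
  rw [← (ValuativeRel.valuation (v.adicCompletion F)).vlt_one_iff,
    (Valued.v (R := v.adicCompletion F)).vlt_one_iff] at h
  have h1 : ((closureAt v).residueChar : v.adicCompletion F) =
      ((algebraMap (𝓞 F) F (closureAt v).residueChar : F) : v.adicCompletion F) := by
    rw [← map_natCast (algebraMap (𝓞 F) (v.adicCompletion F)) (closureAt v).residueChar]
    rfl
  rw [h1, HeightOneSpectrum.adicCompletion.valued_coe] at h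
  exact (v.valuation_lt_one_iff_mem ((closureAt v).residueChar : 𝓞 F)).1 h

/-- A rational prime `p ∈ v` IS the residue characteristic of `K_v` (two primes in a proper ideal coincide). [folklore] -/
theorem eq_residueChar_closureAt_of_natCast_mem {p : ℕ} [hp : Fact p.Prime] (hv : ((p : ℕ) : 𝓞 F) ∈ v.asIdeal) :
    p = (closureAt v).residueChar := by
  haveI := (closureAt v).fact_residueChar_prime
  have h1 := residueChar_eq_of_natCast_mem (F := F) p hv
  have h2 := residueChar_eq_of_natCast_mem (F := F) (closureAt v).residueChar (natCast_residueChar_closureAt_mem v)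
  exact h1.symm.trans h2

/-! ## 2. The Galois logarithm on `𝒪_v^×` is the analytic one -/

section GaloisLog

variable (p : ℕ) [hp : Fact p.Prime] (hv : ((p : ℕ) : 𝓞 F) ∈ v.asIdeal)

omit hp in
/-- A unit of `𝒪_v` has norm `1` in `K_v^{(1/n_v)}`. [cite: NeukirchANT1999, Ch. II Thm. (4.8)] -/
theorem norm_of_coe_unit_eq_one (u : (↥(v.adicCompletionIntegers F))ˣ) :
    ‖RescaledCompletion.of F p v hv (((u : ↥(v.adicCompletionIntegers F)) : v.adicCompletion F))‖ = 1 := by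
  rw [RescaledCompletion.norm_def]
  have hval : Valued.v (RescaledCompletion.of F p v hv (((u : ↥(v.adicCompletionIntegers F)) : v.adicCompletion F))) = 1 :=
    valued_coe_unit v u
  rw [hval, map_one, NNReal.coe_one]

include hv in
/-- **THE GALOIS `p_v`-ADIC LOGARITHM IS THE ANALYTIC ONE** (pointwise form): for every unit `u ∈ 𝒪_v^×` and every prime
`p ∈ v`, c312-1's `Real.galoisLog v u` ([AbsTopIII] Def. 3.1 (i) `log_k̄` restricted to `𝒪_v^× = (𝒪_{K̄_v}^×)^{G_v}`) equals
abc-iut-S1's `log_p u` computed in `K_v^{(1/n_v)}` — the value prescribed by c312-5's `LogvAnalyticAt p`.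
Classical uniqueness of the `p`-adic logarithm, here through: (1) `log_k̄ = e⁻¹ ∘ log_{ℚ̄_p} ∘ e` for an `e : K̄_v ≃ₐ[ℚ_p] ℚ̄_p`
(`MLFClosure.exists_algEquiv_galoisPadicLog_log_eq`); (2) `ι := e ∘ (K_v → K̄_v) : K_v^{(1/n_v)} →ₐ[ℚ_p] ℚ̄_p` is
norm-preserving (`norm_map_algHom_of_isAlgebraic`); (3) `log_p ∘ ι = ι ∘ log_p` into the (complete) image field
(`unitLog_map`) and `log_p = log_{ℚ̄_p}` there (`coe_unitLog_eq_padicLogAlgCl`).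
[cite: MochizukiAbsTopIII2015, Definition 3.1 (i) p.66] [cite: NeukirchANT1999, Ch. II Prop. (5.5)] -/
theorem galoisLog_apply_eq_unitLog (u : (↥(v.adicCompletionIntegers F))ˣ) :
    galoisLog v (Additive.ofMul u) =
      (RescaledCompletion.of F p v hv).symm
        (unitLog (RescaledCompletion.of F p v hv (((u : ↥(v.adicCompletionIntegers F)) : v.adicCompletion F)))) := by
  obtain rfl : p = (closureAt v).residueChar := eq_residueChar_closureAt_of_natCast_mem v hv
  -- notation
  let Kbar : Type := AlgebraicClosure (v.adicCompletion F)
  haveI : CharZero (v.adicCompletion F) := charZero_adicCompletion v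
  have hpk : ValuativeRel.valuation (v.adicCompletion F) (closureAt v).residueChar < 1 :=
    (closureAt v).valuation_ringChar_lt_one
  -- the `ℚ_p`-structures through which `log_k̄` is defined
  letI iQk : Algebra ℚ_[(closureAt v).residueChar] (v.adicCompletion F) :=
    LocalField.padicAlgebra (v.adicCompletion F) (closureAt v).residueChar hpk
  letI iQK : Algebra ℚ_[(closureAt v).residueChar] Kbar :=
    ((algebraMap (v.adicCompletion F) Kbar).comp
      (LocalField.padicRingHom (v.adicCompletion F) (closureAt v).residueChar hpk)).toAlgebra
  -- (1) `log_k̄ = e⁻¹ ∘ log_{ℚ̄_p} ∘ e`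
  obtain ⟨e, he⟩ := (closureAt v).exists_algEquiv_galoisPadicLog_log_eq
  -- the rescaled completion and `ι : K_v^{(1/n_v)} →ₐ[ℚ_p] ℚ̄_p`
  let R : Type := RescaledCompletion F (closureAt v).residueChar v hv
  let φ : R →ₐ[ℚ_[(closureAt v).residueChar]] Kbar :=
    { ((algebraMap (v.adicCompletion F) Kbar).comp
        (RescaledCompletion.of F (closureAt v).residueChar v hv).symm.toRingHom) with
      commutes' := fun _ => rfl }
  let ι : R →ₐ[ℚ_[(closureAt v).residueChar]] PadicAlgCl (closureAt v).residueChar := (e : Kbar →ₐ[_] _).comp φ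
  have hι : ∀ x : R, ι x = e (algebraMap (v.adicCompletion F) Kbar ((RescaledCompletion.of F _ v hv).symm x)) :=
    fun _ => rfl
  -- (2) `ι` is norm-preserving
  haveI : FiniteDimensional ℚ_[(closureAt v).residueChar] R :=
    Literature.IUT.HodgeTheaters.GaloisValDatum.finiteDimensional_rescaledCompletion F _ v hv
  haveI : Algebra.IsAlgebraic ℚ_[(closureAt v).residueChar] R := Algebra.IsAlgebraic.of_finite _ _
  have hιn : ∀ x : R, ‖ι x‖ = ‖x‖ := norm_map_algHom_of_isAlgebraic ι
  -- the finite (hence complete) image field `E = ι(K_v) ⊆ ℚ̄_p`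
  let E : IntermediateField ℚ_[(closureAt v).residueChar] (PadicAlgCl (closureAt v).residueChar) := ι.fieldRange
  have hmemE : ∀ x : R, ι x ∈ E := fun x => ι.mem_fieldRange.mpr ⟨x, rfl⟩
  let σ : R →+* E := ι.toRingHom.codRestrict E hmemE
  have hσ : ∀ x : R, ((σ x : E) : PadicAlgCl (closureAt v).residueChar) = ι x := fun _ => rfl
  have hσn : ∀ x : R, ‖σ x‖ = ‖x‖ := fun x => by
    rw [← hιn x, ← hσ x]
    rfl
  -- `E` is finite-dimensional (image of the finite-dimensional `R`), hence complete
  let l : R →ₗ[ℚ_[(closureAt v).residueChar]] E :=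
    { toFun := σ
      map_add' := fun x y => map_add σ x y
      map_smul' := fun c x => by
        apply Subtype.ext
        rw [RingHom.id_apply, IntermediateField.coe_smul, hσ, hσ, map_smul] }
  have hl : Function.Surjective l := by
    rintro ⟨y, hy⟩
    obtain ⟨x, rfl⟩ := ι.mem_fieldRange.mp hy
    exact ⟨x, rfl⟩
  haveI : FiniteDimensional ℚ_[(closureAt v).residueChar] E := Module.Finite.of_surjective l hl
  haveI : CompleteSpace E := FiniteDimensional.complete ℚ_[(closureAt v).residueChar] E
  -- the unit `u`, read in `R`
  set x : R := RescaledCompletion.of F (closureAt v).residueChar v hv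
    (((u : ↥(v.adicCompletionIntegers F)) : v.adicCompletion F)) with hx
  have hx1 : ‖x‖ = 1 := norm_of_coe_unit_eq_one v _ hv u
  have hσx1 : ‖σ x‖ = 1 := by rw [hσn, hx1]
  -- (3) `log_p` in `E` at `σ x` is the Iwasawa logarithm of `ℚ̄_p`, and `log_p ∘ σ = σ ∘ log_p`
  have hE := coe_unitLog_eq_padicLogAlgCl (closureAt v).residueChar E hσx1
  have hmap : unitLog (σ x) = σ (unitLog x) := unitLog_map (closureAt v).residueChar σ hσn x
  rw [hmap, hσ, hσ] at hE
  -- hE : ι (unitLog x) = padicLogAlgCl _ (ι x)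
  -- assemble in `K̄_v` and descend to `K_v`
  apply (algebraMap (v.adicCompletion F) Kbar).injective
  have hιx : ι x = e (algebraMap (v.adicCompletion F) Kbar (((u : ↥(v.adicCompletionIntegers F)) : v.adicCompletion F))) :=
    rfl
  rw [algebraMap_galoisLog, he, ← hιx, ← hE, hι, AlgEquiv.symm_apply_apply]

include hv in
/-- **`Real.galoisLog v = Real.analyticLogv F v`**: the Galois `p_v`-adic logarithm on `𝒪_v^×` ([AbsTopIII] Def. 3.1 (i), c312-1's
`Thm311RealInd2IsmZHat`) and c312-5's analytic family (abc-iut-S1's `unitLog`, `Thm311RealLog`) are the SAME homomorphism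
`𝒪_v^× → K_v` — the log binder of the `Ẑ^×` non-vacuity is the binder of every other file of the record.
[cite: MochizukiAbsTopIII2015, Definition 3.1 (i) p.66] [cite: NeukirchANT1999, Ch. II Prop. (5.5)] -/
theorem galoisLog_eq_analyticLogv' : galoisLog v = analyticLogv F v := by
  refine AddMonoidHom.ext fun u => ?_
  have h1 := galoisLog_apply_eq_unitLog v p hv (Additive.toMul u)
  have h2 := logvAnalyticAt_analyticLogv (F := F) p v hv (Additive.toMul u)
  exact h1.trans h2.symm

end GaloisLog

/-- **`Real.galoisLog v = Real.analyticLogv F v`** (hypothesis-free form: the residue characteristic of `K_v` is a prime of `v`).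
[cite: MochizukiAbsTopIII2015, Definition 3.1 (i) p.66] [cite: NeukirchANT1999, Ch. II Prop. (5.5)] -/
theorem galoisLog_eq_analyticLogv : galoisLog v = analyticLogv F v :=
  haveI := (closureAt v).fact_residueChar_prime
  galoisLog_eq_analyticLogv' v (closureAt v).residueChar (natCast_residueChar_closureAt_mem v)

/-! ## 3. The `Ẑ^×` non-vacuity for the analytic binder -/

/-- Print's (Ind2)-group at `v` through the Galois logarithm is the one through the analytic logarithm.
[claim: Mochizuki2012, status: disputed] -/
theorem ismIsmOf_galoisLog_eq : ismIsmOf v (galoisLog v) = ismIsmOf v (analyticLogv F v) := by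
  rw [galoisLog_eq_analyticLogv]

section ZHat

variable [Fact (closureAt v).residueChar.Prime]

/-- **NON-VACUITY OF PRINT'S (Ind2) FOR THE ANALYTIC BINDER, `Ẑ^×` form**: for every `û ∈ Ẑ^×`, multiplication by
`χ_p(û) ∈ ℤ_p^×` on `K_v` lies in `Real.ismIsmOf v (analyticLogv F v)` (c312-1's p443508 `mulPadicUnitScalar_mem_ismIsmOf` +
`galoisLog_eq_analyticLogv`). [claim: Mochizuki2012, status: disputed] -/
theorem mulPadicUnitScalar_mem_ismIsmOf_analyticLogv (û : ZHatUnits) :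
    mulPadicUnitScalar v û ∈ ismIsmOf v (analyticLogv F v) := by
  rw [← ismIsmOf_galoisLog_eq]
  exact mulPadicUnitScalar_mem_ismIsmOf v û

end ZHat

/-! ## 4. Print's (Ind2) at `v` through the analytic logarithm is EXACTLY `ℤ_p^×` -/

section Equality

variable (p : ℕ) [hp : Fact p.Prime] (hv : ((p : ℕ) : 𝓞 F) ∈ v.asIdeal)

include hv in
/-- **MEMBERSHIP CRITERION**: a `ℚ`-linear automorphism `ψ` of `K_v` lies in print's (Ind2)-group `Real.ismIsm (analyticLogv F) v`
([IUTchIII] Thm. 3.11 (i) (Ind2) at `v_ℚ ∈ 𝕍^non`, realised `G_v`-isometries of [IUTchII] Ex. 1.8 (iv)) IFF `ψ` is multiplication by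
a `p`-adic UNIT: `∃ c ∈ ℚ_p, ‖c‖ = 1, ψ(a) = c·a` (read in `K_v^{(1/n_v)}`).  (⇒) this lineage's `exists_unit_scalar_of_mem_ismIsm`
(p445977); (⇐) `c = χ_p(û)` for some `û ∈ Ẑ^×` (`ZHatLevel.padicChar_surjective_units`) and c312-1's `Ẑ^×` non-vacuity
transported to the analytic binder. [claim: Mochizuki2012, status: disputed] [cite: RibesZalesskii2010, Thm 2.7.1] -/
theorem mem_ismIsm_analyticLogv_iff_exists_unit_scalar
    (ψ : Carrier (.inr v : Place F) ≃ₗ[ℚ] Carrier (.inr v : Place F)) :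
    ψ ∈ ismIsm (analyticLogv F) v ↔
      ∃ c : ℚ_[p], ‖c‖ = 1 ∧ ∀ a : Carrier (.inr v : Place F),
        RescaledCompletion.of F p v hv (ψ a) = c • RescaledCompletion.of F p v hv a := by
  refine ⟨fun hψ => exists_unit_scalar_of_mem_ismIsm_analyticLogv p v hv hψ, ?_⟩
  rintro ⟨c, hc1, hc⟩
  obtain rfl : p = (closureAt v).residueChar := eq_residueChar_closureAt_of_natCast_mem v hv
  -- `c ∈ ℤ_p^×` is `χ_p(û)` for some `û ∈ Ẑ^×`
  obtain ⟨û, hû⟩ := ZHatLevel.padicChar_surjective_units (closureAt v).residueChar (PadicInt.mkUnits hc1)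
  haveI : CharZero (v.adicCompletion F) := charZero_adicCompletion v
  -- the scalar `c`, through the canonical `ℚ_p → K_v`, is `χ_p(û)` read in `K_v`
  have hscalar : (letI := LocalField.adicCompletionPadicAlgebra v (closureAt v).residueChar hv
      algebraMap ℚ_[(closureAt v).residueChar] (v.adicCompletion F) c) = padicUnitScalar v û := by
    change LocalField.padicRingHom (v.adicCompletion F) (closureAt v).residueChar _ c =
      LocalField.padicRingHom (v.adicCompletion F) (closureAt v).residueChar _
        ((ZHatLevel.padicChar (closureAt v).residueChar û : ℤ_[(closureAt v).residueChar]) :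
          ℚ_[(closureAt v).residueChar])
    rw [hû]
    rfl
  -- `ψ` IS multiplication by `χ_p(û)`
  have hψeq : (ψ.toAddEquiv : v.adicCompletion F ≃+ v.adicCompletion F) = mulPadicUnitScalar v û := by
    refine AddEquiv.ext fun a => ?_
    have ha := hc a
    change RescaledCompletion.of F _ v hv (ψ a) =
      algebraMap ℚ_[(closureAt v).residueChar] (RescaledCompletion F _ v hv) c * RescaledCompletion.of F _ v hv a at ha
    rw [RescaledCompletion.algebraMap_eq, ← map_mul] at ha
    have ha' := (RescaledCompletion.of F _ v hv).injective ha
    exact ha'.trans (congrArg (· * a) hscalar)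
  rw [mem_ismIsm_iff, hψeq]
  exact mulPadicUnitScalar_mem_ismIsmOf_analyticLogv v û

include hv in
/-- **PRINT'S (Ind2)-GROUP AT A FINITE PLACE IS EXACTLY THE `p`-ADIC UNIT SCALARS**: through THE (analytic = Galois) `p_v`-adic
logarithm, c312-1's `Real.ismIsm (analyticLogv F) v` — the bicontinuous automorphisms of `K_v` induced by the `G_v`-isometries of
`O^{×μ}(G_v)` ([IUTchIII] Thm. 3.11 (i) (Ind2) p. 154; Prop. 1.2 (vi); [IUTchII] Ex. 1.8 (iv)) — EQUALS `{a ↦ c·a : c ∈ ℚ_p, ‖c‖ = 1}`: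
Mochizuki's "`Ẑ^× ↠ ℤ_p^× ↪ Ism`" read on `K_v` is a bijection onto the typed group.  (Dupuy–Hilado's `Aut_{ℚ_p}(K_v : I_v)`,
c312-5's `Real.ismDH`, is `GL_{ℤ_p}(I_v)`.) [claim: Mochizuki2012, status: disputed] [cite: DupuyHilado2025, §4.9] -/
theorem ismIsm_analyticLogv_eq_unitScalars :
    ismIsm (analyticLogv F) v =
      {ψ | ∃ c : ℚ_[p], ‖c‖ = 1 ∧ ∀ a : Carrier (.inr v : Place F),
        RescaledCompletion.of F p v hv (ψ a) = c • RescaledCompletion.of F p v hv a} :=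
  Set.ext fun ψ => mem_ismIsm_analyticLogv_iff_exists_unit_scalar v p hv ψ

end Equality

end Summit.ABC.IUTFork.Thm311.Real

end
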